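import Summits.NavierStokesRegularity.NavierStokesRegularity.Theses.PalasekTowerBreakdown
import Summits.NavierStokesRegularity.FluidComputer.PalasekTowerShadowRegistration
import Summits.NavierStokesRegularity.FluidComputer.PalasekTowerShadowRegistrationLite

/-!
# `EpisodeBaseT` (crux stmt-NavierStokesRegularity-20303): THE SHADOW LEMMA of the line «robustmirror» IS A
# THEOREM — the stub `stub_shadow_registersT : ShadowRegistersT` by its unfolded text, with no hypothesis, and
# `EpisodeBaseT` from ONE free run with slack faces (no force anywhere, no symmetry)

Cell `ns-blowup`, seat `ns-blowup-ecbridge-3` (g10; D-0074 GROUP C «BRIDGE SUPPORT», lineage `host_preparation`).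
Route `PalasekTowerBreakdown` rev 19: `EpisodeBaseT := EpisodeBaseGAt TowerRates.tuned`. Crux-strategist line
«robustmirror» (`Cruxes/EpisodeBase/Lines/robustmirror.lean` v4 / `Cruxes/EpisodeBaseT/Lines/robustmirror.lean`,
planner-cstrat-stmt-NavierStokesRegularity-19179; DIRECTOR-NS #64): `EpisodeBaseT_of : SlackFacesT → ShadowRegistersT →
EpisodeBaseT`, `robustNoSwirlRungAtOneT_of : SlackFacesT → ShadowRegistersT → RobustNoSwirlRungAtOneT` and the negative
cascade `not_liveHeredityPairT_of`; its stubs after v4: T1 `stub_slack_facesT` (the 2-D sterile certificate WITH SLACK,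
a computation — tranche 0), T2 `stub_shadow_registersT` (THIS FILE), BU `stub_ns_backward_uniquenessT` (Literature).
LABEL: E–C typing (KERNEL: theorems only; `--supports` stmt-NavierStokesRegularity-20303). WHAT THIS IS NOT: not
Navier–Stokes evidence — no free run with slack faces is exhibited and no certificate is claimed; `EpisodeBaseT` appears
only as the conclusion of a conditional; nothing about `RungG 1`, heredity or blow-up is asserted.

* **`palasekTowerBreakdown_shadowRegistersT`** — THE STUB T2 BY ITS UNFOLDED TEXT, no hypothesis: for every smooth
  divergence-free `u₀` confined to `B̄(0, r)` whose FREE run has the slack faces `SlackFaces u₀ r₁` (`0 < r₁ ≤ r`; the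
  body of cstrat's `def SlackFaces` verbatim), there is `ε > 0` such that every smooth divergence-free rapidly decaying
  `a` confined to `B̄(0, r)`, `ε`-close to `u₀` in value (and in gradient — unused), is the datum of a pinned (`8`, `6/5`)
  rigid quiet UNFORCED tuned schedule of radius `r` with a `Margins.routeG` stage at level `1`. So the line's
  `stub_shadow_registersT` closes by `exact palasekTowerBreakdown_shadowRegistersT` (after importing this module), and
  the crux-of-record composition `EpisodeBaseT_of` needs T1 alone.
* **`palasekTowerBreakdown_episodeBaseT_of_slackFaces`** — `EpisodeBaseT` FROM ONE FREE RUN WITH SLACK FACES: a smooth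
  divergence-free datum confined to a ball whose free run (`ν = 1`, NO force at any time) shows F0–F7 with slack `η`
  ⟹ `EpisodeBaseT`. No axisymmetry / no-swirl hypothesis: the UNFORCED door to the crux (the level-`0` floor is reached
  by the flow itself at its first hitting time; compare the forced doors `…_of_mechanism_freeRun` /
  `…_of_rawCertificateAt` of the line `straindoor`, where a germ host force prepares level `0` at `τ₀ = 1`).

Mechanism (all in the tree, this seat's g10 FluidComputer files): `Shadow.registration_open` at
`TowerRates.tuned_boxNumerics` ← `FreeRun.exists_C1_shadow` (perturbed-datum run + KNSS (4.10) for both runs + Landau)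
← `exists_isLeast_floorTime` (first hitting time by compactness) ← `Schedule.ofWindowsFrom` (re-timed window schedule).

References: S. Palasek, arXiv:2605.13827 §3.3, §4 [cite: Palasek2026ElementaryModel, §3.3]; T. Tao, Anal. PDE 6 (2013)
Thm. 5.4 [cite: Tao2011, Thm. 5.4 (ii)+(iv)]; G. Koch, N. Nadirashvili, G. Seregin, V. Šverák, Acta Math. 203 (2009) §4
(4.10) [cite: KochNadirashviliSereginSverak2009, §4 (4.10)]; G. H. Hardy, J. E. Littlewood, G. Pólya, *Inequalities* §8
[cite: HardyLittlewoodPolya1952, §8 (Landau's inequality)].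
-/

noncomputable section

-- `Summit.<Summit>.<Problem>` is the tree's mandated summit-side namespace (CONVENTIONS §2); for this
-- single-conjunct summit the two coincide, so the duplicate is deliberate.
set_option linter.dupNamespace false

namespace Summit.NavierStokesRegularity.NavierStokesRegularity.Theorems

open Set Function MeasureTheory Metric
open scoped ENNReal ContDiff
open Summit.NavierStokesRegularity.NavierStokesRegularity.Theses
open Summit.NavierStokesRegularity.FluidComputer.PalasekTowerClayBridge
open Literature.Analysis.FluidPDE

/-- **THE SHADOW (RE-TIMING) LEMMA AT THE TUNED RATES — the stub T2 `ShadowRegistersT` of the line «robustmirror» of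
the crux `EpisodeBaseT`, by its unfolded text and with no hypothesis.** Slack faces of the FREE run from a confined
smooth divergence-free datum `u₀` (the body of `SlackFaces u₀ r₁`, `0 < r₁ ≤ r`) make level-`1` registration OPEN at
`u₀` among confined data: some `ε > 0` registers every smooth divergence-free rapidly decaying `a` confined to `B̄(0, r)`
that is `ε`-close to `u₀` in value and gradient, as the datum of a pinned (`8`, `6/5`) rigid quiet unforced tuned
schedule of radius `r` with a `Margins.routeG` stage at level `1`.
[cite: Palasek2026ElementaryModel, §3.3] [cite: Tao2011, Thm. 5.4 (ii)+(iv)] [cite: KochNadirashviliSereginSverak2009, §4 (4.10)] -/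
theorem palasekTowerBreakdown_shadowRegistersT :
    ∀ (u₀ : EuclideanSpace ℝ (Fin 3) → EuclideanSpace ℝ (Fin 3)) (r r₁ : ℝ),
    0 < r₁ → r₁ ≤ r → ContDiff ℝ ∞ u₀ → VectorCalculus.IsDivFree u₀ → (∀ x, r < ‖x‖ → u₀ x = 0) →
    (∃ (u : ℝ → EuclideanSpace ℝ (Fin 3) → EuclideanSpace ℝ (Fin 3)) (p : ℝ → EuclideanSpace ℝ (Fin 3) → ℝ)
      (τ₀ η : ℝ),
      0 < η ∧ η < τ₀ ∧ η < TowerRates.tuned.window 0 ∧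
      IsClassicalNSSolutionOn (Icc 0 (τ₀ + TowerRates.tuned.window 0 + η)) 1 0 u p ∧ u 0 = u₀ ∧
      (∃ C : ℝ≥0∞, C < ⊤ ∧ ∀ t ∈ Icc 0 (τ₀ + TowerRates.tuned.window 0 + η), ∫⁻ x, ‖u t x‖ₑ ^ 2 ≤ C) ∧
      (∀ t ∈ Icc 0 (τ₀ - η), ∀ x, ‖u t x‖ ≤ TowerRates.tuned.Y 0 - η) ∧
      (∀ t ∈ Icc (τ₀ - η) τ₀, ∀ x, ‖u t x‖ ≤ TowerRates.tuned.Y 0 - η * (τ₀ - t)) ∧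
      (∀ t ∈ Icc τ₀ (τ₀ + η), ∃ x, ‖x‖ ≤ r₁ ∧ TowerRates.tuned.Y 0 + η * (t - τ₀) ≤ ‖u t x‖) ∧
      (∀ t ∈ Icc 0 (τ₀ + TowerRates.tuned.window 0 + η), ∀ x, r₁ < ‖x‖ → ‖u t x‖ ≤ TowerRates.tuned.Y 0 - η) ∧
      (∀ t ∈ Icc (τ₀ + TowerRates.tuned.window 0 - η) (τ₀ + TowerRates.tuned.window 0 + η),
        ∃ x, ‖x‖ ≤ r₁ ∧ TowerRates.tuned.Y 1 + η ≤ ‖u t x‖) ∧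
      (∀ t ∈ Icc 0 (τ₀ + TowerRates.tuned.window 0 + η), ∀ x, ‖u t x‖ ≤ 5 / 3 * TowerRates.tuned.Y 1 - η) ∧
      (∀ t ∈ Icc 0 (τ₀ + η), ∀ x, ‖u t x‖ ≤ 5 / 3 * TowerRates.tuned.Y 0 - η) ∧
      (∀ t ∈ Icc (τ₀ - η) (τ₀ + η), ∃ x, ‖x‖ ≤ r₁ ∧ TowerRates.tuned.A 0 + η ≤ ‖fderiv ℝ (u t) x‖) ∧
      (∀ t ∈ Icc (τ₀ + TowerRates.tuned.window 0 - η) (τ₀ + TowerRates.tuned.window 0 + η),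
        ∃ x, ‖x‖ ≤ r₁ ∧ TowerRates.tuned.A 1 + η ≤ ‖fderiv ℝ (u t) x‖) ∧
      (∀ t ∈ Icc (τ₀ - η) (τ₀ + η), ∃ (x : EuclideanSpace ℝ (Fin 3)) (γ : ℝ → EuclideanSpace ℝ (Fin 3)),
        ‖x‖ ≤ r₁ ∧ ContDiff ℝ 1 γ ∧ γ 0 = γ 1 ∧
        (∀ s ∈ Icc (0 : ℝ) 1, γ s ∈ Metric.closedBall x (1 / TowerRates.tuned.N 0)) ∧
        (∀ s ∈ Icc (0 : ℝ) 1, ‖deriv γ s‖ ≤ 8 * Real.pi / TowerRates.tuned.N 0) ∧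
        TowerRates.tuned.N 0 ^ (TowerRates.tuned.β - 2) + η ≤ circulation (u t) γ) ∧
      (∀ t ∈ Icc (τ₀ + TowerRates.tuned.window 0 - η) (τ₀ + TowerRates.tuned.window 0 + η),
        ∃ (x : EuclideanSpace ℝ (Fin 3)) (γ : ℝ → EuclideanSpace ℝ (Fin 3)),
        ‖x‖ ≤ r₁ ∧ ContDiff ℝ 1 γ ∧ γ 0 = γ 1 ∧
        (∀ s ∈ Icc (0 : ℝ) 1, γ s ∈ Metric.closedBall x (1 / TowerRates.tuned.N 1)) ∧
        (∀ s ∈ Icc (0 : ℝ) 1, ‖deriv γ s‖ ≤ 8 * Real.pi / TowerRates.tuned.N 1) ∧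
        TowerRates.tuned.N 1 ^ (TowerRates.tuned.β - 2) + η ≤ circulation (u t) γ)) →
    ∃ ε : ℝ, 0 < ε ∧
      ∀ a : EuclideanSpace ℝ (Fin 3) → EuclideanSpace ℝ (Fin 3),
        ContDiff ℝ ∞ a → VectorCalculus.IsDivFree a → HasRapidSpatialDecay a →
        (∀ x, r < ‖x‖ → a x = 0) →
        (∀ x, ‖a x - u₀ x‖ ≤ ε) → (∀ x, ‖fderiv ℝ a x - fderiv ℝ u₀ x‖ ≤ ε) →
        ∃ S' : Schedule TowerRates.tuned,
          S'.u₀ = a ∧ S'.f = 0 ∧ S'.radius = r ∧ S'.Pins 8 (6 / 5) ∧ S'.Rigid ∧ S'.Quiet ∧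
          Nonempty (Stage 1 TowerRates.tuned S' (Margins.routeG TowerRates.tuned) 1) := by
  intro u₀ r r₁ _hr₁ hr₁r _hu₀ _hdiv _hconf hF
  obtain ⟨u, p, τ₀, η, hη, hητ, hηw, hcl, hu0, hE, hF0, hF1a, hF1b, hF2, hF3, hF4, hF5, hF6a, hF6b, hF7a, hF7b⟩ :=
    hF
  obtain ⟨ε, hε, hopen⟩ := Shadow.registration_open TowerRates.tuned_boxNumerics hr₁r hη hητ hηw hcl hE hF0 hF1a
    hF1b hF2 hF3 hF4 hF5 hF6a hF6b hF7a hF7b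
  refine ⟨ε, hε, fun a ha hadiv hadec haconf ha0 _ha1 => ?_⟩
  exact hopen a ha hadiv hadec haconf (fun x => by rw [hu0]; exact ha0 x)

/-- **`EpisodeBaseT` FROM ONE FREE RUN WITH SLACK FACES** (the UNFORCED door to the crux of record; no symmetry
hypothesis). If a smooth divergence-free datum `u₀` confined to `B̄(0, r)` has a classical finite-energy FREE run
(`ν = 1`, no force at any time) on `[0, τ₀ + w₀ + η]` (`w₀ = tuned.window 0`, slack `0 < η < min(τ₀, w₀)`) showing,
in a ball `‖x‖ ≤ r₁ ≤ r`, `0 < r₁`, the slack faces F0–F7 of the tuned register (the body of cstrat's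
`SlackFaces u₀ r₁` verbatim), then `EpisodeBaseT` holds: the design is the unforced re-timed window schedule from `u₀`
read at the run's first hitting time of the level-`0` floor.
[cite: Palasek2026ElementaryModel, §3.3] [cite: Tao2011, Thm. 5.4 (ii)+(iv)] -/
theorem palasekTowerBreakdown_episodeBaseT_of_slackFaces
    {u₀ : EuclideanSpace ℝ (Fin 3) → EuclideanSpace ℝ (Fin 3)} {r r₁ : ℝ}
    (hr₁ : 0 < r₁) (hr₁r : r₁ ≤ r) (hu₀ : ContDiff ℝ ∞ u₀) (hdiv : VectorCalculus.IsDivFree u₀)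
    (hconf : ∀ x, r < ‖x‖ → u₀ x = 0)
    (hF : ∃ (u : ℝ → EuclideanSpace ℝ (Fin 3) → EuclideanSpace ℝ (Fin 3)) (p : ℝ → EuclideanSpace ℝ (Fin 3) → ℝ)
      (τ₀ η : ℝ),
      0 < η ∧ η < τ₀ ∧ η < TowerRates.tuned.window 0 ∧
      IsClassicalNSSolutionOn (Icc 0 (τ₀ + TowerRates.tuned.window 0 + η)) 1 0 u p ∧ u 0 = u₀ ∧
      (∃ C : ℝ≥0∞, C < ⊤ ∧ ∀ t ∈ Icc 0 (τ₀ + TowerRates.tuned.window 0 + η), ∫⁻ x, ‖u t x‖ₑ ^ 2 ≤ C) ∧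
      (∀ t ∈ Icc 0 (τ₀ - η), ∀ x, ‖u t x‖ ≤ TowerRates.tuned.Y 0 - η) ∧
      (∀ t ∈ Icc (τ₀ - η) τ₀, ∀ x, ‖u t x‖ ≤ TowerRates.tuned.Y 0 - η * (τ₀ - t)) ∧
      (∀ t ∈ Icc τ₀ (τ₀ + η), ∃ x, ‖x‖ ≤ r₁ ∧ TowerRates.tuned.Y 0 + η * (t - τ₀) ≤ ‖u t x‖) ∧
      (∀ t ∈ Icc 0 (τ₀ + TowerRates.tuned.window 0 + η), ∀ x, r₁ < ‖x‖ → ‖u t x‖ ≤ TowerRates.tuned.Y 0 - η) ∧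
      (∀ t ∈ Icc (τ₀ + TowerRates.tuned.window 0 - η) (τ₀ + TowerRates.tuned.window 0 + η),
        ∃ x, ‖x‖ ≤ r₁ ∧ TowerRates.tuned.Y 1 + η ≤ ‖u t x‖) ∧
      (∀ t ∈ Icc 0 (τ₀ + TowerRates.tuned.window 0 + η), ∀ x, ‖u t x‖ ≤ 5 / 3 * TowerRates.tuned.Y 1 - η) ∧
      (∀ t ∈ Icc 0 (τ₀ + η), ∀ x, ‖u t x‖ ≤ 5 / 3 * TowerRates.tuned.Y 0 - η) ∧
      (∀ t ∈ Icc (τ₀ - η) (τ₀ + η), ∃ x, ‖x‖ ≤ r₁ ∧ TowerRates.tuned.A 0 + η ≤ ‖fderiv ℝ (u t) x‖) ∧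
      (∀ t ∈ Icc (τ₀ + TowerRates.tuned.window 0 - η) (τ₀ + TowerRates.tuned.window 0 + η),
        ∃ x, ‖x‖ ≤ r₁ ∧ TowerRates.tuned.A 1 + η ≤ ‖fderiv ℝ (u t) x‖) ∧
      (∀ t ∈ Icc (τ₀ - η) (τ₀ + η), ∃ (x : EuclideanSpace ℝ (Fin 3)) (γ : ℝ → EuclideanSpace ℝ (Fin 3)),
        ‖x‖ ≤ r₁ ∧ ContDiff ℝ 1 γ ∧ γ 0 = γ 1 ∧
        (∀ s ∈ Icc (0 : ℝ) 1, γ s ∈ Metric.closedBall x (1 / TowerRates.tuned.N 0)) ∧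
        (∀ s ∈ Icc (0 : ℝ) 1, ‖deriv γ s‖ ≤ 8 * Real.pi / TowerRates.tuned.N 0) ∧
        TowerRates.tuned.N 0 ^ (TowerRates.tuned.β - 2) + η ≤ circulation (u t) γ) ∧
      (∀ t ∈ Icc (τ₀ + TowerRates.tuned.window 0 - η) (τ₀ + TowerRates.tuned.window 0 + η),
        ∃ (x : EuclideanSpace ℝ (Fin 3)) (γ : ℝ → EuclideanSpace ℝ (Fin 3)),
        ‖x‖ ≤ r₁ ∧ ContDiff ℝ 1 γ ∧ γ 0 = γ 1 ∧
        (∀ s ∈ Icc (0 : ℝ) 1, γ s ∈ Metric.closedBall x (1 / TowerRates.tuned.N 1)) ∧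
        (∀ s ∈ Icc (0 : ℝ) 1, ‖deriv γ s‖ ≤ 8 * Real.pi / TowerRates.tuned.N 1) ∧
        TowerRates.tuned.N 1 ^ (TowerRates.tuned.β - 2) + η ≤ circulation (u t) γ)) :
    PalasekTowerBreakdown.EpisodeBaseT := by
  obtain ⟨ε, hε, hopen⟩ := palasekTowerBreakdown_shadowRegistersT u₀ r r₁ hr₁ hr₁r hu₀ hdiv hconf hF
  have hsupp : HasCompactSupport u₀ := by
    refine HasCompactSupport.of_support_subset_isCompact
      (isCompact_closedBall (0 : EuclideanSpace ℝ (Fin 3)) r) fun x hx => ?_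
    rw [Metric.mem_closedBall, dist_zero_right]
    by_contra h
    exact hx (hconf x (lt_of_not_ge h))
  obtain ⟨S', -, -, -, hP, hR, hQ, hs⟩ := hopen u₀ hu₀ hdiv (HasRapidSpatialDecay.of_hasCompactSupport hu₀ hsupp)
    hconf (fun x => by simp [hε.le]) (fun x => by simp [hε.le])
  exact ⟨S', hP, hR, hQ, hs⟩

/-- **`EpisodeBaseT` FROM ONE FREE RUN WITH THE LITE SLACK FACES** (appended 2026-08-27 by the same seat after
the tranche-0 rows; the UNFORCED door with the cheaper letter of `PalasekTowerShadowRegistrationLite`). A smooth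
divergence-free datum `u₀` confined to `B̄(0, r)` with a classical finite-energy FREE run (`ν = 1`, no force at any
time) on `[0, τ₀ + w₀ + η]` (`w₀ = tuned.window 0`, `0 < η < τ₀`) showing: F0 early anchor, F1 transversal crossing
of `Y₀` at `τ₀` read in a hitting ball `‖x‖ ≤ r₁ ≤ r`, F2″ far field `≤ Y₀ − η` outside `r₁` DURING THE CROSSING
`[τ₀ − η, τ₀ + η]` only, F4/F5 ceilings, and the readout faces F3/F6/F7 of both levels anywhere in the schedule ball
`‖x‖ ≤ r` ⟹ `EpisodeBaseT`. [cite: Palasek2026ElementaryModel, §3.3] [cite: Tao2011, Thm. 5.4 (ii)+(iv)] -/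
theorem palasekTowerBreakdown_episodeBaseT_of_slackFacesLite
    {u₀ : EuclideanSpace ℝ (Fin 3) → EuclideanSpace ℝ (Fin 3)} {r r₁ : ℝ}
    {u : ℝ → EuclideanSpace ℝ (Fin 3) → EuclideanSpace ℝ (Fin 3)} {p : ℝ → EuclideanSpace ℝ (Fin 3) → ℝ}
    {τ₀ η : ℝ} (hr₁r : r₁ ≤ r) (hconf : ∀ x, r < ‖x‖ → u₀ x = 0) (hη : 0 < η) (hητ : η < τ₀)
    (hcl : IsClassicalNSSolutionOn (Icc 0 (τ₀ + TowerRates.tuned.window 0 + η)) 1 0 u p) (hu0 : u 0 = u₀)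
    (hE : ∃ C : ℝ≥0∞, C < ⊤ ∧ ∀ t ∈ Icc 0 (τ₀ + TowerRates.tuned.window 0 + η), ∫⁻ x, ‖u t x‖ₑ ^ 2 ≤ C)
    (hF0 : ∀ t ∈ Icc 0 (τ₀ - η), ∀ x, ‖u t x‖ ≤ TowerRates.tuned.Y 0 - η)
    (hF1a : ∀ t ∈ Icc (τ₀ - η) τ₀, ∀ x, ‖u t x‖ ≤ TowerRates.tuned.Y 0 - η * (τ₀ - t))
    (hF1b : ∀ t ∈ Icc τ₀ (τ₀ + η), ∃ x, ‖x‖ ≤ r₁ ∧ TowerRates.tuned.Y 0 + η * (t - τ₀) ≤ ‖u t x‖)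
    (hF2 : ∀ t ∈ Icc (τ₀ - η) (τ₀ + η), ∀ x, r₁ < ‖x‖ → ‖u t x‖ ≤ TowerRates.tuned.Y 0 - η)
    (hF3 : ∀ t ∈ Icc (τ₀ + TowerRates.tuned.window 0 - η) (τ₀ + TowerRates.tuned.window 0 + η),
      ∃ x, ‖x‖ ≤ r ∧ TowerRates.tuned.Y 1 + η ≤ ‖u t x‖)
    (hF4 : ∀ t ∈ Icc 0 (τ₀ + TowerRates.tuned.window 0 + η), ∀ x, ‖u t x‖ ≤ 5 / 3 * TowerRates.tuned.Y 1 - η)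
    (hF5 : ∀ t ∈ Icc 0 (τ₀ + η), ∀ x, ‖u t x‖ ≤ 5 / 3 * TowerRates.tuned.Y 0 - η)
    (hF6a : ∀ t ∈ Icc (τ₀ - η) (τ₀ + η), ∃ x, ‖x‖ ≤ r ∧ TowerRates.tuned.A 0 + η ≤ ‖fderiv ℝ (u t) x‖)
    (hF6b : ∀ t ∈ Icc (τ₀ + TowerRates.tuned.window 0 - η) (τ₀ + TowerRates.tuned.window 0 + η),
      ∃ x, ‖x‖ ≤ r ∧ TowerRates.tuned.A 1 + η ≤ ‖fderiv ℝ (u t) x‖)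
    (hF7a : ∀ t ∈ Icc (τ₀ - η) (τ₀ + η), ∃ (x : EuclideanSpace ℝ (Fin 3)) (γ : ℝ → EuclideanSpace ℝ (Fin 3)),
      ‖x‖ ≤ r ∧ ContDiff ℝ 1 γ ∧ γ 0 = γ 1 ∧
      (∀ s ∈ Icc (0 : ℝ) 1, γ s ∈ Metric.closedBall x (1 / TowerRates.tuned.N 0)) ∧
      (∀ s ∈ Icc (0 : ℝ) 1, ‖deriv γ s‖ ≤ 8 * Real.pi / TowerRates.tuned.N 0) ∧
      TowerRates.tuned.N 0 ^ (TowerRates.tuned.β - 2) + η ≤ circulation (u t) γ)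
    (hF7b : ∀ t ∈ Icc (τ₀ + TowerRates.tuned.window 0 - η) (τ₀ + TowerRates.tuned.window 0 + η),
      ∃ (x : EuclideanSpace ℝ (Fin 3)) (γ : ℝ → EuclideanSpace ℝ (Fin 3)),
      ‖x‖ ≤ r ∧ ContDiff ℝ 1 γ ∧ γ 0 = γ 1 ∧
      (∀ s ∈ Icc (0 : ℝ) 1, γ s ∈ Metric.closedBall x (1 / TowerRates.tuned.N 1)) ∧
      (∀ s ∈ Icc (0 : ℝ) 1, ‖deriv γ s‖ ≤ 8 * Real.pi / TowerRates.tuned.N 1) ∧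
      TowerRates.tuned.N 1 ^ (TowerRates.tuned.β - 2) + η ≤ circulation (u t) γ) :
    PalasekTowerBreakdown.EpisodeBaseT := by
  have hconf0 : ∀ x, r < ‖x‖ → u 0 x = 0 := by rw [hu0]; exact hconf
  exact Shadow.episodeBaseGAt_of_slackFacesLite TowerRates.tuned_boxNumerics hr₁r hη hητ hcl hconf0 hE hF0 hF1a
    hF1b hF2 hF3 hF4 hF5 hF6a hF6b hF7a hF7b

end Summit.NavierStokesRegularity.NavierStokesRegularity.Theorems

end
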